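import Summits.NavierStokesRegularity.FunctionalMining.QuadraticBudgetWitnessField
import Mathlib.Analysis.Calculus.BumpFunction.Normed
import HarnessLib

/-!
# Functional mining: a compactly supported divergence-free field on `ℝ³` with non-zero
# enstrophy production (no-go branch, row C1)

Search for candidate a priori estimates; no regularity claim.

Cell `pub-nsfunc` (host summit NavierStokesRegularity, topic `FunctionalMining`), NO-GO branch,
target `EnstrophyQuadraticBudget C` (`RateBudgets.lean`, census row C1). The concentrating family
that kills the row for every `C` (`QuadraticBudgetStatic.lean`, `QuadraticBudgetPlanting.lean`)
needs ONE seed: a smooth, compactly supported, divergence-free `U` on `ℝ³` with production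
`σ(U) = ∫⟪(U·∇)U, ΔU⟫ ≠ 0`. Bump fields have transcendental integrals, so `σ` is never
computed; its SIGN is forced by a perturbation argument:
* `production_add_smul`, `exists_production_ne_zero` — along a line `V + εW` of `C²_c` fields
  `σ` is a real cubic in `ε`; a cubic vanishing at `ε = 0, 1, −1, 2` is zero, so a non-zero
  linear coefficient `A₁ = ∫ (⟪(W·∇)V, ΔV⟫ + ⟪(V·∇)W, ΔV⟫ + ⟪(V·∇)V, ΔW⟫)` forces
  `σ(V + εW) ≠ 0` for one of these `ε`;
* `linearCoeff_eq_four_mul_integral` — for `V` equal to the HARMONIC quadratic field `vQ` of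
  `QuadraticBudgetWitnessField` on the unit ball and `W = curl(β e₀)`, `β` a bump supported in
  the unit ball: the first two terms vanish identically (`ΔV = 0` on `supp W`) and the third is
  `∫⟪Δ((V·∇)V), W⟫ = ∫ β ⟪curl Δ nQ, e₀⟫ = ∫ β · Δ(3y₂² − y₁²) = 4 ∫β` (Green
  `integral_inner_laplacian_comm`, `integral_inner_curl_eq_integral_inner_curl`, `curl Δ = Δ curl`,
  tree files `FluidPDE/ClassicalSolutionCalculus`, `FluidPDE/VorticityCalculus`);
* `exists_compactSupport_divFree_production_pos` — some `U = ± curl(χ pot + ε β e₀)` is smooth,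
  supported in `B̄(0, 2)`, divergence free (`div curl = 0`) and has `σ(U) > 0`.
No definitions (the bumps are Mathlib `ContDiffBump`s chosen inside the final proof).
-/

noncomputable section

open MeasureTheory Set Filter Topology InnerProductSpace Metric
open scoped RealInnerProductSpace Laplacian ContDiff

namespace Summit.NavierStokesRegularity.FunctionalMining

open Literature.Analysis.FluidPDE

namespace BumpWitness

/-! ## Integrability and the cubic expansion of the production along `V + ε W` -/

/-- The Laplacian of a compactly supported field is compactly supported. [folklore] -/
theorem hasCompactSupport_laplacian {Z : EuclideanSpace ℝ (Fin 3) → EuclideanSpace ℝ (Fin 3)}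
    (hZc : HasCompactSupport Z) : HasCompactSupport (Δ Z) :=
  hZc.mono' fun x hx => by
    by_contra h
    exact hx (laplacian_eq_zero_of_notMem_tsupport h)

/-- The Laplacian of a smooth field is smooth (`Δ = Σᵢ ∂ᵢ∂ᵢ`). [folklore] -/
theorem contDiff_laplacian_of_smooth {Z : EuclideanSpace ℝ (Fin 3) → EuclideanSpace ℝ (Fin 3)}
    (hZ : ContDiff ℝ ∞ Z) : ContDiff ℝ ∞ (Δ Z) := by
  have h : Δ Z = fun x => ∑ i, fderiv ℝ (fun y => fderiv ℝ Z y (stdOrthonormalBasis ℝ _ i)) x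
      (stdOrthonormalBasis ℝ _ i) :=
    funext fun x => laplacian_eq_sum_fderiv_fderiv _ (hZ.of_le (WithTop.coe_le_coe.mpr le_top)) x
  rw [h]
  refine ContDiff.sum fun i _ => ?_
  have h1 : ContDiff ℝ ∞ fun y => fderiv ℝ Z y (stdOrthonormalBasis ℝ _ i) :=
    (hZ.fderiv_right (m := ∞) le_rfl).clm_apply contDiff_const
  exact (h1.fderiv_right (m := ∞) le_rfl).clm_apply contDiff_const

/-- `y ↦ ⟪DX(y) (Y y), ΔZ(y)⟫` is integrable for `X, Z ∈ C²`, `Y` continuous, `Z` compactly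
supported. [folklore] -/
theorem integrable_inner_fderiv_laplacian {X Y Z : EuclideanSpace ℝ (Fin 3) → EuclideanSpace ℝ (Fin 3)}
    (hX : ContDiff ℝ 2 X) (hY : Continuous Y) (hZ : ContDiff ℝ 2 Z) (hZc : HasCompactSupport Z) :
    Integrable (fun y => ⟪fderiv ℝ X y (Y y), Δ Z y⟫) (volume : Measure (EuclideanSpace ℝ (Fin 3))) :=
  integrable_inner_of_hasCompactSupport_right ((hX.continuous_fderiv (by norm_num)).clm_apply hY)
    (continuous_laplacian hZ) (hasCompactSupport_laplacian hZc)

/-- `∫ (a₀ + ε a₁ + ε² a₂ + ε³ a₃) = ∫a₀ + ε∫a₁ + ε²∫a₂ + ε³∫a₃` for integrable coefficients.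
[folklore] -/
theorem integral_cubic_poly {a₀ a₁ a₂ a₃ : EuclideanSpace ℝ (Fin 3) → ℝ}
    (h₀ : Integrable a₀ (volume : Measure (EuclideanSpace ℝ (Fin 3))))
    (h₁ : Integrable a₁ (volume : Measure (EuclideanSpace ℝ (Fin 3))))
    (h₂ : Integrable a₂ (volume : Measure (EuclideanSpace ℝ (Fin 3))))
    (h₃ : Integrable a₃ (volume : Measure (EuclideanSpace ℝ (Fin 3)))) (ε : ℝ) :
    (∫ y, (a₀ y + ε * a₁ y + ε ^ 2 * a₂ y + ε ^ 3 * a₃ y)) =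
      (∫ y, a₀ y) + ε * (∫ y, a₁ y) + ε ^ 2 * (∫ y, a₂ y) + ε ^ 3 * ∫ y, a₃ y := by
  have I1 : Integrable (fun y => ε * a₁ y) (volume : Measure (EuclideanSpace ℝ (Fin 3))) := h₁.const_mul ε
  have I2 : Integrable (fun y => ε ^ 2 * a₂ y) (volume : Measure (EuclideanSpace ℝ (Fin 3))) := h₂.const_mul _
  have I3 : Integrable (fun y => ε ^ 3 * a₃ y) (volume : Measure (EuclideanSpace ℝ (Fin 3))) := h₃.const_mul _
  have I01 : Integrable (fun y => a₀ y + ε * a₁ y) (volume : Measure (EuclideanSpace ℝ (Fin 3))) :=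
    h₀.add I1
  have I012 : Integrable (fun y => a₀ y + ε * a₁ y + ε ^ 2 * a₂ y)
      (volume : Measure (EuclideanSpace ℝ (Fin 3))) := I01.add I2
  have e3 : (∫ y, (a₀ y + ε * a₁ y + ε ^ 2 * a₂ y + ε ^ 3 * a₃ y)) =
      (∫ y, (a₀ y + ε * a₁ y + ε ^ 2 * a₂ y)) + ∫ y, ε ^ 3 * a₃ y := integral_add I012 I3
  have e2 : (∫ y, (a₀ y + ε * a₁ y + ε ^ 2 * a₂ y)) =
      (∫ y, (a₀ y + ε * a₁ y)) + ∫ y, ε ^ 2 * a₂ y := integral_add I01 I2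
  have e1 : (∫ y, (a₀ y + ε * a₁ y)) = (∫ y, a₀ y) + ∫ y, ε * a₁ y := integral_add h₀ I1
  rw [e3, e2, e1, integral_const_mul, integral_const_mul, integral_const_mul]

variable {V W : EuclideanSpace ℝ (Fin 3) → EuclideanSpace ℝ (Fin 3)}

/-- **Cubic expansion of the enstrophy production along a line of fields.** For `C²` compactly
supported `V, W` on `ℝ³` and `ε ∈ ℝ`, with `σ(U) = ∫⟪(U·∇)U, ΔU⟫`:
`σ(V + εW) = σ(V) + ε A₁ + ε² A₂ + ε³ σ(W)` with
`A₁ = ∫ (⟪(W·∇)V, ΔV⟫ + ⟪(V·∇)W, ΔV⟫ + ⟪(V·∇)V, ΔW⟫)`,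
`A₂ = ∫ (⟪(W·∇)W, ΔV⟫ + ⟪(V·∇)W, ΔW⟫ + ⟪(W·∇)V, ΔW⟫)` (trilinearity). [folklore] -/
theorem production_add_smul (hV : ContDiff ℝ 2 V) (hVc : HasCompactSupport V) (hW : ContDiff ℝ 2 W)
    (hWc : HasCompactSupport W) (ε : ℝ) :
    (∫ y, ⟪fderiv ℝ (fun z => V z + ε • W z) y (V y + ε • W y), Δ (fun z => V z + ε • W z) y⟫) =
      (∫ y, ⟪fderiv ℝ V y (V y), Δ V y⟫) +
        ε * (∫ y, (⟪fderiv ℝ V y (W y), Δ V y⟫ + ⟪fderiv ℝ W y (V y), Δ V y⟫ +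
          ⟪fderiv ℝ V y (V y), Δ W y⟫)) +
        ε ^ 2 * (∫ y, (⟪fderiv ℝ W y (W y), Δ V y⟫ + ⟪fderiv ℝ W y (V y), Δ W y⟫ +
          ⟪fderiv ℝ V y (W y), Δ W y⟫)) +
        ε ^ 3 * ∫ y, ⟪fderiv ℝ W y (W y), Δ W y⟫ := by
  have hVd : ∀ y, DifferentiableAt ℝ V y := fun y => (hV.differentiable (by norm_num)) y
  have hWd : ∀ y, DifferentiableAt ℝ W y := fun y => (hW.differentiable (by norm_num)) y
  -- pointwise expansion
  have hpt : ∀ y, ⟪fderiv ℝ (fun z => V z + ε • W z) y (V y + ε • W y), Δ (fun z => V z + ε • W z) y⟫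
      = ⟪fderiv ℝ V y (V y), Δ V y⟫ +
        ε * (⟪fderiv ℝ V y (W y), Δ V y⟫ + ⟪fderiv ℝ W y (V y), Δ V y⟫ +
          ⟪fderiv ℝ V y (V y), Δ W y⟫) +
        ε ^ 2 * (⟪fderiv ℝ W y (W y), Δ V y⟫ + ⟪fderiv ℝ W y (V y), Δ W y⟫ +
          ⟪fderiv ℝ V y (W y), Δ W y⟫) +
        ε ^ 3 * ⟪fderiv ℝ W y (W y), Δ W y⟫ := by
    intro y
    have hD : fderiv ℝ (fun z => V z + ε • W z) y = fderiv ℝ V y + ε • fderiv ℝ W y := by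
      have hW' : DifferentiableAt ℝ (fun z => ε • W z) y := (hWd y).const_smul ε
      rw [fderiv_fun_add (hVd y) hW', fderiv_fun_const_smul (hWd y)]
    have hL : Δ (fun z => V z + ε • W z) y = Δ V y + ε • Δ W y := by
      have h1 : (fun z => V z + ε • W z) = V + ε • W := rfl
      have hW' : ContDiff ℝ 2 (ε • W) := hW.const_smul ε
      rw [h1, (hV.contDiffAt).laplacian_add hW'.contDiffAt, laplacian_smul ε hW.contDiffAt]
    rw [hD, hL]
    simp only [add_apply, smul_apply, map_add, map_smul, inner_add_left, inner_add_right,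
      real_inner_smul_left, real_inner_smul_right]
    ring
  -- integrability of the coefficients
  have i0 := integrable_inner_fderiv_laplacian hV hV.continuous hV hVc
  have i1a := integrable_inner_fderiv_laplacian hV hW.continuous hV hVc
  have i1b := integrable_inner_fderiv_laplacian hW hV.continuous hV hVc
  have i1c := integrable_inner_fderiv_laplacian hV hV.continuous hW hWc
  have i2a := integrable_inner_fderiv_laplacian hW hW.continuous hV hVc
  have i2b := integrable_inner_fderiv_laplacian hW hV.continuous hW hWc
  have i2c := integrable_inner_fderiv_laplacian hV hW.continuous hW hWc
  have i3 := integrable_inner_fderiv_laplacian hW hW.continuous hW hWc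
  have i1 := (i1a.add i1b).add i1c
  have i2 := (i2a.add i2b).add i2c
  rw [integral_congr_ae (ae_of_all _ hpt)]
  exact integral_cubic_poly i0 i1 i2 i3 ε

/-- **A non-zero linear coefficient forces a non-zero production somewhere on the line**: a real
cubic vanishing at `ε = 0, 1, −1, 2` is identically zero, so if `A₁ ≠ 0` then
`σ(V + εW) ≠ 0` for some `ε ∈ {0, 1, −1, 2}`. [folklore] -/
theorem exists_production_ne_zero (hV : ContDiff ℝ 2 V) (hVc : HasCompactSupport V)
    (hW : ContDiff ℝ 2 W) (hWc : HasCompactSupport W)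
    (hA : (∫ y, (⟪fderiv ℝ V y (W y), Δ V y⟫ + ⟪fderiv ℝ W y (V y), Δ V y⟫ +
          ⟪fderiv ℝ V y (V y), Δ W y⟫)) ≠ 0) :
    ∃ ε : ℝ, (∫ y, ⟪fderiv ℝ (fun z => V z + ε • W z) y (V y + ε • W y),
      Δ (fun z => V z + ε • W z) y⟫) ≠ 0 := by
  by_contra h
  push Not at h
  have h0 := h 0
  have h1 := h 1
  have hm := h (-1)
  have h2 := h 2
  rw [production_add_smul hV hVc hW hWc] at h0 h1 hm h2
  norm_num at h0 h1 hm h2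
  apply hA
  linarith

/-! ## The linear coefficient along a bump perturbation of the planted quadratic field -/

/-- **The linear coefficient is `4 ∫β`.** Let `V ∈ C^∞_c(ℝ³; ℝ³)` coincide with the harmonic
quadratic field `vQ` on the unit ball, and let `W = curl (β e₀)` with `β ∈ C^∞_c` supported in the
unit ball. Then
`∫ (⟪(W·∇)V, ΔV⟫ + ⟪(V·∇)W, ΔV⟫ + ⟪(V·∇)V, ΔW⟫) = 4 ∫ β`:
the first two integrands vanish identically (`ΔV = ΔvQ = 0` where `W ≠ 0`), and
`∫⟪(V·∇)V, ΔW⟫ = ∫⟪Δ((V·∇)V), curl(β e₀)⟫ = ∫ β ⟪curl Δ ((vQ·∇)vQ), e₀⟫ = ∫ β · Δ(3y₂² − y₁²) = 4∫β`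
(Green's identity `integral_inner_laplacian_comm`, the curl integration by parts
`integral_inner_curl_eq_integral_inner_curl`, `curl Δ = Δ curl`, and the explicit field
computations of `QuadraticBudgetWitnessField`). [folklore] -/
theorem linearCoeff_eq_four_mul_integral {β : EuclideanSpace ℝ (Fin 3) → ℝ}
    (hV : ContDiff ℝ ∞ V) (hVc : HasCompactSupport V)
    (hVq : ∀ y ∈ Metric.ball (0 : EuclideanSpace ℝ (Fin 3)) 1, V y = vQ y)
    (hβ : ContDiff ℝ ∞ β) (hβc : HasCompactSupport β)
    (hβs : tsupport β ⊆ Metric.ball (0 : EuclideanSpace ℝ (Fin 3)) 1)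
    (hW : W = curl fun y => β y • e 0) :
    (∫ y, (⟪fderiv ℝ V y (W y), Δ V y⟫ + ⟪fderiv ℝ W y (V y), Δ V y⟫ +
        ⟪fderiv ℝ V y (V y), Δ W y⟫)) = 4 * ∫ y, β y := by
  -- the perturbing potential `Ψ = β e₀`
  set Ψ : EuclideanSpace ℝ (Fin 3) → EuclideanSpace ℝ (Fin 3) := fun y => β y • e 0 with hΨdef
  have hΨ : ContDiff ℝ ∞ Ψ := hβ.smul contDiff_const
  have hΨsupp : tsupport Ψ ⊆ tsupport β :=
    closure_mono fun y hy => by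
      contrapose! hy
      simp [hΨdef, Function.notMem_support.1 hy]
  have hΨc : HasCompactSupport Ψ := hβc.mono' (subset_closure.trans hΨsupp)
  have hΨ1 : ContDiff ℝ 1 Ψ := hΨ.of_le (WithTop.coe_le_coe.mpr le_top)
  have hWs : ContDiff ℝ ∞ W := hW ▸ contDiff_curl (n := ⊤) (hΨ.of_le (by exact_mod_cast le_top))
  have hWc : HasCompactSupport W := hW ▸ hasCompactSupport_curl hΨc
  have hW0 : ∀ y, y ∉ tsupport β → W y = 0 := fun y hy => by
    rw [hW]; exact curl_eq_zero_of_notMem_tsupport fun h => hy (hΨsupp h)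
  have hWsupp : tsupport W ⊆ tsupport β :=
    closure_minimal (fun y hy => by by_contra h; exact hy (hW0 y h)) (isClosed_tsupport β)
  have hDW0 : ∀ y, y ∉ tsupport β → fderiv ℝ W y = 0 := fun y hy =>
    fderiv_of_notMem_tsupport ℝ fun h => hy (hWsupp h)
  -- `V = vQ` near every point of the unit ball: `ΔV = 0` there, `(V·∇)V = nQ` there
  have hVq' : ∀ y ∈ Metric.ball (0 : EuclideanSpace ℝ (Fin 3)) 1, V =ᶠ[𝓝 y] vQ := fun y hy =>
    Filter.eventuallyEq_of_mem (Metric.isOpen_ball.mem_nhds hy) hVq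
  have hΔV : ∀ y ∈ Metric.ball (0 : EuclideanSpace ℝ (Fin 3)) 1, Δ V y = 0 := fun y hy => by
    rw [(laplacian_congr_nhds (hVq' y hy)).eq_of_nhds, laplacian_vQ]
  set N : EuclideanSpace ℝ (Fin 3) → EuclideanSpace ℝ (Fin 3) := fun y => fderiv ℝ V y (V y)
    with hNdef
  have hN : ContDiff ℝ ∞ N := (hV.fderiv_right (m := ∞) le_rfl).clm_apply hV
  have hNc : HasCompactSupport N := hVc.mono fun y hy => by
    contrapose! hy
    simp [hNdef, Function.notMem_support.1 hy]
  have hNq : ∀ y ∈ Metric.ball (0 : EuclideanSpace ℝ (Fin 3)) 1, N y = nQ y := fun y hy => by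
    simp only [hNdef]
    rw [(hVq' y hy).fderiv_eq, hVq y hy, convect_vQ]
  have hNq' : ∀ y ∈ Metric.ball (0 : EuclideanSpace ℝ (Fin 3)) 1, N =ᶠ[𝓝 y] nQ := fun y hy =>
    Filter.eventuallyEq_of_mem (Metric.isOpen_ball.mem_nhds hy) hNq
  -- the first two integrands vanish identically
  have hT1 : ∀ y, ⟪fderiv ℝ V y (W y), Δ V y⟫ = 0 := fun y => by
    by_cases hy : y ∈ Metric.ball (0 : EuclideanSpace ℝ (Fin 3)) 1
    · rw [hΔV y hy, inner_zero_right]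
    · rw [hW0 y fun h => hy (hβs h), map_zero, inner_zero_left]
  have hT2 : ∀ y, ⟪fderiv ℝ W y (V y), Δ V y⟫ = 0 := fun y => by
    by_cases hy : y ∈ Metric.ball (0 : EuclideanSpace ℝ (Fin 3)) 1
    · rw [hΔV y hy, inner_zero_right]
    · rw [hDW0 y fun h => hy (hβs h)]
      simp
  -- the third: Green, curl integration by parts, and the explicit Laplacian
  have hT3 : (∫ y, ⟪fderiv ℝ V y (V y), Δ W y⟫) = 4 * ∫ y, β y := by
    have ha : (∫ y, ⟪N y, Δ W y⟫) = ∫ y, ⟪Δ N y, W y⟫ :=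
      (integral_inner_laplacian_comm (hN.of_le (WithTop.coe_le_coe.mpr le_top)) (hWs.of_le (WithTop.coe_le_coe.mpr le_top)) hWc).symm
    have hΔN : ContDiff ℝ ∞ (Δ N) := contDiff_laplacian_of_smooth hN
    have hb : (∫ y, ⟪Δ N y, W y⟫) = ∫ y, ⟪curl (Δ N) y, Ψ y⟫ := by
      rw [hW]
      exact (integral_inner_curl_eq_integral_inner_curl (hΔN.of_le (WithTop.coe_le_coe.mpr le_top)) hΨ1 hΨc).symm
    have hc : ∀ y, ⟪curl (Δ N) y, Ψ y⟫ = 4 * β y := fun y => by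
      have hinner : ⟪curl (Δ N) y, Ψ y⟫ = β y * curl (Δ N) y 0 := by
        simp [hΨdef, e, real_inner_smul_right, EuclideanSpace.inner_single_right]
      rw [hinner]
      by_cases hy : y ∈ tsupport β
      · have hyb : y ∈ Metric.ball (0 : EuclideanSpace ℝ (Fin 3)) 1 := hβs hy
        have h1 : curl (Δ N) y = Δ (curl N) y := curl_laplacian (hN.of_le (WithTop.coe_le_coe.mpr le_top)) y
        have h2 : (Δ (curl N) y) 0 = Δ (fun z => curl N z 0) y := by
          have hcd : ContDiffAt ℝ 2 (curl N) y :=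
            ((contDiff_curl (n := 2) (hN.of_le (WithTop.coe_le_coe.mpr le_top))).contDiffAt)
          have := hcd.laplacian_CLM_comp_left (l := (EuclideanSpace.proj 0 :
            EuclideanSpace ℝ (Fin 3) →L[ℝ] ℝ))
          exact this.symm
        have h3 : (fun z => curl N z 0) =ᶠ[𝓝 y] fun z : EuclideanSpace ℝ (Fin 3) =>
            (3 * z 2 ^ 2 - z 1 ^ 2 : ℝ) := by
          filter_upwards [Metric.isOpen_ball.mem_nhds hyb] with z hz
          rw [curl_eq_curlCLM, (hNq' z hz).fderiv_eq, ← curl_eq_curlCLM, curl_nQ_zero]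
        rw [h1, h2, (laplacian_congr_nhds h3).eq_of_nhds, laplacian_curl_nQ_zero]
        ring
      · simp [image_eq_zero_of_notMem_tsupport hy]
    rw [ha, hb, integral_congr_ae (ae_of_all _ hc), integral_const_mul]
  -- assemble
  have hsum : ∀ y, ⟪fderiv ℝ V y (W y), Δ V y⟫ + ⟪fderiv ℝ W y (V y), Δ V y⟫ +
      ⟪fderiv ℝ V y (V y), Δ W y⟫ = ⟪fderiv ℝ V y (V y), Δ W y⟫ := fun y => by
    rw [hT1 y, hT2 y, zero_add, zero_add]
  rw [integral_congr_ae (ae_of_all _ hsum), hT3]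

/-! ## The witness: a compactly supported divergence-free field with positive production -/

/-- Production flips sign with the field: `σ(−U) = −σ(U)` (the integrand is cubic). [folklore] -/
theorem production_neg (U : EuclideanSpace ℝ (Fin 3) → EuclideanSpace ℝ (Fin 3)) :
    (∫ y, ⟪fderiv ℝ (fun z => -U z) y (-U y), Δ (fun z => -U z) y⟫) =
      -∫ y, ⟪fderiv ℝ U y (U y), Δ U y⟫ := by
  rw [← integral_neg]
  refine integral_congr_ae (ae_of_all _ fun y => ?_)
  dsimp only
  rw [show (fun z => -U z) = -U from rfl, fderiv_neg, laplacian_neg]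
  simp [inner_neg_right]

/-- **The planted-bump witness, for given bumps.** For a plateau bump `χ` (`= 1` on the unit
ball, supported in radius `2`) and a bump `β` supported in radius `½`, some field
`U = ± curl(χ · pot + ε β e₀)`, `ε ∈ {0, 1, −1, 2}`, is smooth, divergence free, supported in
the closed ball of radius `2`, and has strictly positive enstrophy production `∫⟪(U·∇)U, ΔU⟫`.
[folklore] -/
theorem exists_production_pos_of_bumps (χ β : ContDiffBump (0 : EuclideanSpace ℝ (Fin 3)))
    (hχ1 : χ.rIn = 1) (hχ2 : χ.rOut = 2) (hβ2 : β.rOut = 2⁻¹) :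
    ∃ U : EuclideanSpace ℝ (Fin 3) → EuclideanSpace ℝ (Fin 3), ContDiff ℝ ∞ U ∧
      tsupport U ⊆ Metric.closedBall 0 2 ∧ (∀ y, VectorCalculus.divergence U y = 0) ∧
      0 < ∫ y, ⟪fderiv ℝ U y (U y), Δ U y⟫ := by
  -- potentials `P = χ pot`, `Ψ = β e₀` (generalised to keep terms small)
  obtain ⟨P, hPdef⟩ : ∃ P : EuclideanSpace ℝ (Fin 3) → EuclideanSpace ℝ (Fin 3),
      P = fun y => (χ : EuclideanSpace ℝ (Fin 3) → ℝ) y • pot y := ⟨_, rfl⟩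
  obtain ⟨Ψ, hΨdef⟩ : ∃ Ψ : EuclideanSpace ℝ (Fin 3) → EuclideanSpace ℝ (Fin 3),
      Ψ = fun y => (β : EuclideanSpace ℝ (Fin 3) → ℝ) y • e 0 := ⟨_, rfl⟩
  have hP : ContDiff ℝ ∞ P := hPdef ▸ χ.contDiff.smul contDiff_pot
  have hΨ : ContDiff ℝ ∞ Ψ := hΨdef ▸ β.contDiff.smul contDiff_const
  have hPd : ∀ y, DifferentiableAt ℝ P y := fun y => (hP.differentiable (by simp)) y
  have hΨd : ∀ y, DifferentiableAt ℝ Ψ y := fun y => (hΨ.differentiable (by simp)) y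
  -- supports
  have hP0 : ∀ y, (χ : EuclideanSpace ℝ (Fin 3) → ℝ) y = 0 → P y = 0 := fun y hy => by
    rw [hPdef]; simp [hy]
  have hΨ0 : ∀ y, (β : EuclideanSpace ℝ (Fin 3) → ℝ) y = 0 → Ψ y = 0 := fun y hy => by
    rw [hΨdef]; simp [hy]
  have hPc : HasCompactSupport P := χ.hasCompactSupport.mono fun y hy => by
    contrapose! hy
    exact Function.notMem_support.2 (hP0 y (Function.notMem_support.1 hy))
  have hΨc : HasCompactSupport Ψ := β.hasCompactSupport.mono fun y hy => by
    contrapose! hy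
    exact Function.notMem_support.2 (hΨ0 y (Function.notMem_support.1 hy))
  have hβsupp : tsupport (β : EuclideanSpace ℝ (Fin 3) → ℝ) ⊆
      Metric.ball (0 : EuclideanSpace ℝ (Fin 3)) 1 := by
    rw [β.tsupport_eq, hβ2]
    exact Metric.closedBall_subset_ball (by norm_num)
  -- `V = curl P`, `W = curl Ψ`
  have hV : ContDiff ℝ ∞ (curl P) := contDiff_curl (n := ⊤) (hP.of_le (by exact_mod_cast le_top))
  have hW : ContDiff ℝ ∞ (curl Ψ) := contDiff_curl (n := ⊤) (hΨ.of_le (by exact_mod_cast le_top))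
  have hVc : HasCompactSupport (curl P) := hasCompactSupport_curl hPc
  have hWc : HasCompactSupport (curl Ψ) := hasCompactSupport_curl hΨc
  -- `curl P = vQ` on the unit ball (`χ = 1` there)
  have hVq : ∀ y ∈ Metric.ball (0 : EuclideanSpace ℝ (Fin 3)) 1, curl P y = vQ y := fun y hy => by
    have h1 : (χ : EuclideanSpace ℝ (Fin 3) → ℝ) =ᶠ[𝓝 y] 1 :=
      χ.eventuallyEq_one_of_mem_ball (by rw [hχ1]; exact hy)
    have h2 : P =ᶠ[𝓝 y] pot := by
      filter_upwards [h1] with z hz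
      rw [hPdef]
      simp [hz]
    rw [curl_eq_curlCLM, h2.fderiv_eq, ← curl_eq_curlCLM, curl_pot]
  -- the linear coefficient is `4 ∫β > 0`, so some `ε` gives non-zero production
  have hA := linearCoeff_eq_four_mul_integral (W := curl Ψ) hV hVc hVq β.contDiff
    β.hasCompactSupport hβsupp (by rw [hΨdef])
  have hβpos : 0 < ∫ y, (β : EuclideanSpace ℝ (Fin 3) → ℝ) y := β.integral_pos
  have hA' : (∫ y, (⟪fderiv ℝ (curl P) y (curl Ψ y), Δ (curl P) y⟫ +
      ⟪fderiv ℝ (curl Ψ) y (curl P y), Δ (curl P) y⟫ +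
        ⟪fderiv ℝ (curl P) y (curl P y), Δ (curl Ψ) y⟫)) ≠ 0 := by
    rw [hA]; positivity
  obtain ⟨ε, hε⟩ := exists_production_ne_zero (hV.of_le (WithTop.coe_le_coe.mpr le_top)) hVc
    (hW.of_le (WithTop.coe_le_coe.mpr le_top)) hWc hA'
  -- `Φ = P + ε Ψ`, `curl Φ = curl P + ε curl Ψ`
  obtain ⟨Φ, hΦdef⟩ : ∃ Φ : EuclideanSpace ℝ (Fin 3) → EuclideanSpace ℝ (Fin 3),
      Φ = fun y => P y + ε • Ψ y := ⟨_, rfl⟩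
  have hΦ : ContDiff ℝ ∞ Φ := hΦdef ▸ hP.add (hΨ.const_smul ε)
  have hcurlΦ : curl Φ = fun y => curl P y + ε • curl Ψ y := by
    funext y
    have hΨ' : DifferentiableAt ℝ (fun z => ε • Ψ z) y := (hΨd y).const_smul ε
    rw [hΦdef, curl_add (hPd y) hΨ', curl_const_smul (hΨd y)]
  have hΦsupp : tsupport Φ ⊆ Metric.closedBall (0 : EuclideanSpace ℝ (Fin 3)) 2 := by
    have h1 : Function.support Φ ⊆ Metric.ball 0 2 := fun y hy => by
      by_contra hy'
      have hχ0 : (χ : EuclideanSpace ℝ (Fin 3) → ℝ) y = 0 := by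
        apply Function.notMem_support.1
        rw [χ.support_eq, hχ2]
        exact hy'
      have hβ0 : (β : EuclideanSpace ℝ (Fin 3) → ℝ) y = 0 := by
        apply Function.notMem_support.1
        rw [β.support_eq, hβ2]
        exact fun h => hy' (Metric.ball_subset_ball (by norm_num) h)
      refine hy ?_
      rw [hΦdef]
      simp only [hP0 y hχ0, hΨ0 y hβ0, smul_zero, add_zero]
    calc tsupport Φ = closure (Function.support Φ) := rfl
      _ ⊆ closure (Metric.ball 0 2) := closure_mono h1
      _ = Metric.closedBall 0 2 := closure_ball 0 two_ne_zero
  -- properties of `curl Φ'` for a smooth potential supported in the ball of radius `2`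
  have key : ∀ Φ' : EuclideanSpace ℝ (Fin 3) → EuclideanSpace ℝ (Fin 3), ContDiff ℝ ∞ Φ' →
      tsupport Φ' ⊆ Metric.closedBall 0 2 →
      ContDiff ℝ ∞ (curl Φ') ∧ tsupport (curl Φ') ⊆ Metric.closedBall 0 2 ∧
        ∀ y, VectorCalculus.divergence (curl Φ') y = 0 := fun Φ' hΦ' hs =>
    ⟨contDiff_curl (n := ⊤) (hΦ'.of_le (by exact_mod_cast le_top)),
      (closure_minimal (fun y hy => by by_contra h; exact hy (curl_eq_zero_of_notMem_tsupport h))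
        (isClosed_tsupport Φ')).trans hs,
      fun y => divergence_curl_eq_zero_holds Φ' (hΦ'.of_le (WithTop.coe_le_coe.mpr le_top)) y⟩
  rcases lt_or_gt_of_ne hε with hneg | hpos
  · -- negative production: flip the sign of the potential
    have hnegsupp : tsupport (fun y => -Φ y) ⊆ Metric.closedBall (0 : EuclideanSpace ℝ (Fin 3)) 2 := by
      rw [show (fun y => -Φ y) = -Φ from rfl, tsupport_neg]
      exact hΦsupp
    obtain ⟨k1, k2, k3⟩ := key _ hΦ.neg hnegsupp
    refine ⟨curl fun y => -Φ y, k1, k2, k3, ?_⟩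
    have h1 : (curl fun y => -Φ y) = fun y => -(curl Φ) y := funext fun y => curl_neg Φ y
    rw [h1, production_neg, hcurlΦ]
    linarith
  · obtain ⟨k1, k2, k3⟩ := key Φ hΦ hΦsupp
    exact ⟨curl Φ, k1, k2, k3, by rwa [hcurlΦ]⟩

/-- **The planted-bump witness.** There is a smooth divergence-free vector field `U` on `ℝ³`,
supported in the closed ball of radius `2`, with strictly positive enstrophy production
`∫⟪(U·∇)U, ΔU⟫ > 0` (`exists_production_pos_of_bumps` with Mathlib's `ContDiffBump`s of radii
`(1, 2)` and `(¼, ½)`). No transcendental integral is evaluated: the sign comes from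
`4 ∫β > 0`. This is the `ℝ³` seed of the concentrating family that refutes census row C1
(`EnstrophyQuadraticBudget C`, every `C`). [folklore] -/
theorem exists_compactSupport_divFree_production_pos :
    ∃ U : EuclideanSpace ℝ (Fin 3) → EuclideanSpace ℝ (Fin 3), ContDiff ℝ ∞ U ∧
      tsupport U ⊆ Metric.closedBall 0 2 ∧ (∀ y, VectorCalculus.divergence U y = 0) ∧
      0 < ∫ y, ⟪fderiv ℝ U y (U y), Δ U y⟫ :=
  exists_production_pos_of_bumps ⟨1, 2, one_pos, one_lt_two⟩
    ⟨4⁻¹, 2⁻¹, by norm_num, by norm_num⟩ rfl rfl rfl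

end BumpWitness

end Summit.NavierStokesRegularity.FunctionalMining

end
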